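import Mathlib
import Summits.SmoothPoincare4.Statement
import Summits.SmoothPoincare4.SmoothPoincare4.Theses.RootDecompY
import Literature.Topology.FourManifolds.ConnectedSum
import Literature.Topology.FourManifolds.ComplexProjectiveSpace

/-!
# Line «odd-dual» (v3: hypothesis-free `_of`, stub names distinct from the sibling line on #31189) for the crux `RootDecompY.DefiniteTwoStepDescent` (stmt-SmoothPoincare4-31190)

Skeleton (CRUX-PLAN shape): two registered stubs — the ARRANGEMENT stub (new, the load-bearing one) and the
EXCHANGE stub (cited: Gluck 1962 reglue dichotomy + Akbulut–Yasui arXiv:1205.6038 Thm 1.1, see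
`pub/decomp-sp4/decomp-sp4-lens-6/v10/NODE.md` §2) — and the kernel-checked composition `DefiniteTwoStepDescent_of`
concluding the BORN crux decl by name.  Statements are one-line `Prop`s over tree declarations (no local defs,
no notation); sorries ONLY inside `stub_*`.
-/

noncomputable section

set_option linter.dupNamespace false

open scoped Manifold ContDiff

namespace Summit.SmoothPoincare4.SmoothPoincare4.Cruxes.DefiniteTwoStepDescent.OddDual

/-- stub (load-bearing, NEW): odd–dual ARRANGEMENT — the hypothesis of `DefiniteTwoStepDescent` VERBATIM implies the odd–dual
normal form `NF(M)` (some identification `φ : P₂ ≅ Y = ℂℙ² # ℂℙ²` under which the image of a line of the last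
summand meets a standard line `A` of one `Y`-summand transversally in exactly one point, both missing a standard
line `B` of the other summand). -/
theorem stub_definiteArrangement :
    open scoped ContDiff in ∀ (M : Type) [TopologicalSpace M] [T2Space M] [SecondCountableTopology M] [ChartedSpace (EuclideanSpace ℝ (Fin 4)) M] [IsManifold (𝓡 4) ∞ M], ContinuousMap.HomotopyEquiv M (Metric.sphere (0 : EuclideanSpace ℝ (Fin 5)) 1) → (∃ (P₁ P₂ R : Type) (_ : TopologicalSpace P₁) (_ : T2Space P₁) (_ : SecondCountableTopology P₁) (_ : ChartedSpace (EuclideanSpace ℝ (Fin 4)) P₁) (_ : IsManifold (𝓡 4) ∞ P₁) (_ : TopologicalSpace P₂) (_ : T2Space P₂) (_ : SecondCountableTopology P₂) (_ : ChartedSpace (EuclideanSpace ℝ (Fin 4)) P₂) (_ : IsManifold (𝓡 4) ∞ P₂) (_ : TopologicalSpace R) (_ : T2Space R) (_ : SecondCountableTopology R) (_ : ChartedSpace (EuclideanSpace ℝ (Fin 4)) R) (_ : IsManifold (𝓡 4) ∞ R), Literature.Topology.FourManifolds.IsConnectedSum (𝓡 4) (𝓡 4) (𝓡 4) M Literature.Topology.FourManifolds.ComplexProjectivePlane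 P₁ ∧ Literature.Topology.FourManifolds.IsConnectedSum (𝓡 4) (𝓡 4) (𝓡 4) P₁ Literature.Topology.FourManifolds.ComplexProjectivePlane P₂ ∧ (∃ (c : Literature.Topology.FourManifolds.SmoothOrientation (𝓡 4) Literature.Topology.FourManifolds.ComplexProjectivePlane) (oR : Literature.Topology.FourManifolds.SmoothOrientation (𝓡 4) R), Literature.Topology.FourManifolds.IsOrientedConnectedSum c c oR) ∧ Nonempty (P₂ ≃ₘ⟮𝓡 4, 𝓡 4⟯ R)) → ∃ (P₁ P₂ Y : Type) (_ : TopologicalSpace P₁) (_ : T2Space P₁) (_ : SecondCountableTopology P₁) (_ : ChartedSpace (EuclideanSpace ℝ (Fin 4)) P₁) (_ : IsManifold (𝓡 4) ∞ P₁) (_ : TopologicalSpace P₂) (_ : T2Space P₂) (_ : SecondCountableTopology P₂) (_ : ChartedSpace (EuclideanSpace ℝ (Fin 4)) P₂) (_ : IsManifold (𝓡 4) ∞ P₂) (_ : TopologicalSpace Y) (_ : T2Space Y) (_ : SecondCountableTopology Y) (_ : ChartedSpace (EuclideanSpace ℝ (Fin 4)) Y) (_ : IsManifold (𝓡 4) ∞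 Y), Literature.Topology.FourManifolds.IsConnectedSum (𝓡 4) (𝓡 4) (𝓡 4) M Literature.Topology.FourManifolds.ComplexProjectivePlane P₁ ∧ ∃ (i₁ : EuclideanSpace ℝ (Fin 4) → P₁) (i₂ : EuclideanSpace ℝ (Fin 4) → Literature.Topology.FourManifolds.ComplexProjectivePlane) (jA : ↥(Literature.Topology.FourManifolds.puncture i₁) → P₂) (jB : ↥(Literature.Topology.FourManifolds.puncture i₂) → P₂) (k₁ : EuclideanSpace ℝ (Fin 4) → Literature.Topology.FourManifolds.ComplexProjectivePlane) (k₂ : EuclideanSpace ℝ (Fin 4) → Literature.Topology.FourManifolds.ComplexProjectivePlane) (lA : ↥(Literature.Topology.FourManifolds.puncture k₁) → Y) (lB : ↥(Literature.Topology.FourManifolds.puncture k₂) → Y) (φ : P₂ ≃ₘ⟮𝓡 4, 𝓡 4⟯ Y) (a₁ a₂ a₃ : Fin 3 → ℂ), (Manifold.IsSmoothEmbedding 𝓘(ℝ, EuclideanSpace ℝ (Fin 4)) (𝓡 4) ∞ i₁ ∧ Manifold.IsSmoothEmbedding 𝓘(ℝ, EuclideanSpace ℝ (Fin 4)) (𝓡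 4) ∞ i₂ ∧ Manifold.IsSmoothEmbedding (𝓡 4) (𝓡 4) ∞ jA ∧ IsOpen (Set.range jA) ∧ Manifold.IsSmoothEmbedding (𝓡 4) (𝓡 4) ∞ jB ∧ IsOpen (Set.range jB) ∧ Set.range jA ∪ Set.range jB = Set.univ ∧ (∀ a b, jA a = jB b ↔ Literature.Topology.FourManifolds.connectedSumRel i₁ i₂ a b)) ∧ (Manifold.IsSmoothEmbedding 𝓘(ℝ, EuclideanSpace ℝ (Fin 4)) (𝓡 4) ∞ k₁ ∧ Manifold.IsSmoothEmbedding 𝓘(ℝ, EuclideanSpace ℝ (Fin 4)) (𝓡 4) ∞ k₂ ∧ Manifold.IsSmoothEmbedding (𝓡 4) (𝓡 4) ∞ lA ∧ IsOpen (Set.range lA) ∧ Manifold.IsSmoothEmbedding (𝓡 4) (𝓡 4) ∞ lB ∧ IsOpen (Set.range lB) ∧ Set.range lA ∪ Set.range lB = Set.univ ∧ (∀ a b, lA a = lB b ↔ Literature.Topology.FourManifolds.connectedSumRel k₁ k₂ a b)) ∧ a₁ ≠ 0 ∧ a₂ ≠ 0 ∧ a₃ ≠ 0 ∧ i₂ 0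 ∉ {p : Literature.Topology.FourManifolds.ComplexProjectivePlane | ∃ v : {v : Fin 3 → ℂ // v ≠ 0}, Literature.Topology.FourManifolds.ComplexProjectiveSpace.mk v = p ∧ ∑ j, a₁ j * v.1 j = 0} ∧ k₂ 0 ∉ {p : Literature.Topology.FourManifolds.ComplexProjectivePlane | ∃ v : {v : Fin 3 → ℂ // v ≠ 0}, Literature.Topology.FourManifolds.ComplexProjectiveSpace.mk v = p ∧ ∑ j, a₂ j * v.1 j = 0} ∧ k₁ 0 ∉ {p : Literature.Topology.FourManifolds.ComplexProjectivePlane | ∃ v : {v : Fin 3 → ℂ // v ≠ 0}, Literature.Topology.FourManifolds.ComplexProjectiveSpace.mk v = p ∧ ∑ j, a₃ j * v.1 j = 0} ∧ ∃ (S A B : Set Y), S = (fun x => φ x) '' (jB '' {b : ↥(Literature.Topology.FourManifolds.puncture i₂) | (b : Literature.Topology.FourManifolds.ComplexProjectivePlane) ∈ {p : Literature.Topology.FourManifolds.ComplexProjectivePlane | ∃ v : {v : Fin 3 → ℂ // v ≠ 0}, Literature.Topology.FourManifolds.ComplexProjectiveSpace.mk v = p ∧ ∑ j, a₁ j * v.1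 j = 0}}) ∧ A = lB '' {b : ↥(Literature.Topology.FourManifolds.puncture k₂) | (b : Literature.Topology.FourManifolds.ComplexProjectivePlane) ∈ {p : Literature.Topology.FourManifolds.ComplexProjectivePlane | ∃ v : {v : Fin 3 → ℂ // v ≠ 0}, Literature.Topology.FourManifolds.ComplexProjectiveSpace.mk v = p ∧ ∑ j, a₂ j * v.1 j = 0}} ∧ B = lA '' {b : ↥(Literature.Topology.FourManifolds.puncture k₁) | (b : Literature.Topology.FourManifolds.ComplexProjectivePlane) ∈ {p : Literature.Topology.FourManifolds.ComplexProjectivePlane | ∃ v : {v : Fin 3 → ℂ // v ≠ 0}, Literature.Topology.FourManifolds.ComplexProjectiveSpace.mk v = p ∧ ∑ j, a₃ j * v.1 j = 0}} ∧ (∃ p : Y, S ∩ A = {p} ∧ ∃ e : OpenPartialHomeomorph Y (EuclideanSpace ℝ (Fin 4)), e ∈ IsManifold.maximalAtlas (𝓡 4) ∞ Y ∧ p ∈ e.source ∧ ∀ q ∈ e.source, (q ∈ S ↔ (e q) 1 = (e p) 1 ∧ (e q) 3 = (e p) 3) ∧ (q ∈ A ↔ (e q) 0 = (e p) 0 ∧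 (e q) 2 = (e p) 2)) ∧ Disjoint B (S ∪ A) := by
  sorry

/-- stub (cited; COSTUME modulo the exchange lemma): odd–dual EXCHANGE — `NF(M)` implies `M # ℂℙ² ≅ ℂℙ²`
(blow down `S` versus `A`: Gluck 1962 + Akbulut–Yasui 2013 Thm 1.1, the odd sphere `B` kills the Gluck twist). -/
theorem stub_definiteExchange :
    open scoped ContDiff in ∀ (M : Type) [TopologicalSpace M] [T2Space M] [SecondCountableTopology M] [ChartedSpace (EuclideanSpace ℝ (Fin 4)) M] [IsManifold (𝓡 4) ∞ M], ContinuousMap.HomotopyEquiv M (Metric.sphere (0 : EuclideanSpace ℝ (Fin 5)) 1) → (∃ (P₁ P₂ Y : Type) (_ : TopologicalSpace P₁) (_ : T2Space P₁) (_ : SecondCountableTopology P₁) (_ : ChartedSpace (EuclideanSpace ℝ (Fin 4)) P₁) (_ : IsManifold (𝓡 4) ∞ P₁) (_ : TopologicalSpace P₂) (_ : T2Space P₂) (_ : SecondCountableTopology P₂) (_ : ChartedSpace (EuclideanSpace ℝ (Fin 4)) P₂) (_ : IsManifold (𝓡 4) ∞ P₂) (_ : TopologicalSpace Y) (_ : T2Space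 Y) (_ : SecondCountableTopology Y) (_ : ChartedSpace (EuclideanSpace ℝ (Fin 4)) Y) (_ : IsManifold (𝓡 4) ∞ Y), Literature.Topology.FourManifolds.IsConnectedSum (𝓡 4) (𝓡 4) (𝓡 4) M Literature.Topology.FourManifolds.ComplexProjectivePlane P₁ ∧ ∃ (i₁ : EuclideanSpace ℝ (Fin 4) → P₁) (i₂ : EuclideanSpace ℝ (Fin 4) → Literature.Topology.FourManifolds.ComplexProjectivePlane) (jA : ↥(Literature.Topology.FourManifolds.puncture i₁) → P₂) (jB : ↥(Literature.Topology.FourManifolds.puncture i₂) → P₂) (k₁ : EuclideanSpace ℝ (Fin 4) → Literature.Topology.FourManifolds.ComplexProjectivePlane) (k₂ : EuclideanSpace ℝ (Fin 4) → Literature.Topology.FourManifolds.ComplexProjectivePlane) (lA : ↥(Literature.Topology.FourManifolds.puncture k₁) → Y) (lB : ↥(Literature.Topology.FourManifolds.puncture k₂) → Y) (φ : P₂ ≃ₘ⟮𝓡 4, 𝓡 4⟯ Y) (a₁ a₂ a₃ : Fin 3 → ℂ), (Manifold.IsSmoothEmbedding 𝓘(ℝ, EuclideanSpace ℝ (Fin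 4)) (𝓡 4) ∞ i₁ ∧ Manifold.IsSmoothEmbedding 𝓘(ℝ, EuclideanSpace ℝ (Fin 4)) (𝓡 4) ∞ i₂ ∧ Manifold.IsSmoothEmbedding (𝓡 4) (𝓡 4) ∞ jA ∧ IsOpen (Set.range jA) ∧ Manifold.IsSmoothEmbedding (𝓡 4) (𝓡 4) ∞ jB ∧ IsOpen (Set.range jB) ∧ Set.range jA ∪ Set.range jB = Set.univ ∧ (∀ a b, jA a = jB b ↔ Literature.Topology.FourManifolds.connectedSumRel i₁ i₂ a b)) ∧ (Manifold.IsSmoothEmbedding 𝓘(ℝ, EuclideanSpace ℝ (Fin 4)) (𝓡 4) ∞ k₁ ∧ Manifold.IsSmoothEmbedding 𝓘(ℝ, EuclideanSpace ℝ (Fin 4)) (𝓡 4) ∞ k₂ ∧ Manifold.IsSmoothEmbedding (𝓡 4) (𝓡 4) ∞ lA ∧ IsOpen (Set.range lA) ∧ Manifold.IsSmoothEmbedding (𝓡 4) (𝓡 4) ∞ lB ∧ IsOpen (Set.range lB) ∧ Set.range lA ∪ Set.range lB = Set.univ ∧ (∀ a b, lA a = lB b ↔ Literature.Topology.FourManifolds.connectedSumRel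 k₁ k₂ a b)) ∧ a₁ ≠ 0 ∧ a₂ ≠ 0 ∧ a₃ ≠ 0 ∧ i₂ 0 ∉ {p : Literature.Topology.FourManifolds.ComplexProjectivePlane | ∃ v : {v : Fin 3 → ℂ // v ≠ 0}, Literature.Topology.FourManifolds.ComplexProjectiveSpace.mk v = p ∧ ∑ j, a₁ j * v.1 j = 0} ∧ k₂ 0 ∉ {p : Literature.Topology.FourManifolds.ComplexProjectivePlane | ∃ v : {v : Fin 3 → ℂ // v ≠ 0}, Literature.Topology.FourManifolds.ComplexProjectiveSpace.mk v = p ∧ ∑ j, a₂ j * v.1 j = 0} ∧ k₁ 0 ∉ {p : Literature.Topology.FourManifolds.ComplexProjectivePlane | ∃ v : {v : Fin 3 → ℂ // v ≠ 0}, Literature.Topology.FourManifolds.ComplexProjectiveSpace.mk v = p ∧ ∑ j, a₃ j * v.1 j = 0} ∧ ∃ (S A B : Set Y), S = (fun x => φ x) '' (jB '' {b : ↥(Literature.Topology.FourManifolds.puncture i₂) | (b : Literature.Topology.FourManifolds.ComplexProjectivePlane) ∈ {p : Literature.Topology.FourManifolds.ComplexProjectivePlane | ∃ v : {v : Fin 3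 → ℂ // v ≠ 0}, Literature.Topology.FourManifolds.ComplexProjectiveSpace.mk v = p ∧ ∑ j, a₁ j * v.1 j = 0}}) ∧ A = lB '' {b : ↥(Literature.Topology.FourManifolds.puncture k₂) | (b : Literature.Topology.FourManifolds.ComplexProjectivePlane) ∈ {p : Literature.Topology.FourManifolds.ComplexProjectivePlane | ∃ v : {v : Fin 3 → ℂ // v ≠ 0}, Literature.Topology.FourManifolds.ComplexProjectiveSpace.mk v = p ∧ ∑ j, a₂ j * v.1 j = 0}} ∧ B = lA '' {b : ↥(Literature.Topology.FourManifolds.puncture k₁) | (b : Literature.Topology.FourManifolds.ComplexProjectivePlane) ∈ {p : Literature.Topology.FourManifolds.ComplexProjectivePlane | ∃ v : {v : Fin 3 → ℂ // v ≠ 0}, Literature.Topology.FourManifolds.ComplexProjectiveSpace.mk v = p ∧ ∑ j, a₃ j * v.1 j = 0}} ∧ (∃ p : Y, S ∩ A = {p} ∧ ∃ e : OpenPartialHomeomorph Y (EuclideanSpace ℝ (Fin 4)), e ∈ IsManifold.maximalAtlas (𝓡 4) ∞ Y ∧ p ∈ e.source ∧ ∀ q ∈ e.source, (q ∈ S ↔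 (e q) 1 = (e p) 1 ∧ (e q) 3 = (e p) 3) ∧ (q ∈ A ↔ (e q) 0 = (e p) 0 ∧ (e q) 2 = (e p) 2)) ∧ Disjoint B (S ∪ A)) → ∃ (P : Type) (_ : TopologicalSpace P) (_ : T2Space P) (_ : SecondCountableTopology P) (_ : ChartedSpace (EuclideanSpace ℝ (Fin 4)) P) (_ : IsManifold (𝓡 4) ∞ P), Literature.Topology.FourManifolds.IsConnectedSum (𝓡 4) (𝓡 4) (𝓡 4) M Literature.Topology.FourManifolds.ComplexProjectivePlane P ∧ Nonempty (P ≃ₘ⟮𝓡 4, 𝓡 4⟯ Literature.Topology.FourManifolds.ComplexProjectivePlane) := by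
  sorry

/-- The line concludes the crux BY NAME and USES the registered stubs (critic decomp-sp4-crit-1 g4 CLEARED 806 W1:
the sorries of `stub_definiteArrangement` / `stub_definiteExchange` must be reachable from the crux): type = the born route decl literally. -/
theorem DefiniteTwoStepDescent_of : Summit.SmoothPoincare4.SmoothPoincare4.Theses.RootDecompY.DefiniteTwoStepDescent :=
  fun M _ _ _ _ _ e hdata => stub_definiteExchange M e (stub_definiteArrangement M e hdata)

end Summit.SmoothPoincare4.SmoothPoincare4.Cruxes.DefiniteTwoStepDescent.OddDual
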